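import Summits.MatrixMultiplication.OmegaCensus.ThreeSetNoPartThreeGeneral

/-!
# Triangle tilings of a punctured finite abelian group: generation and the bound `|A| ≤ 12·ord + 7` (kernel)

ω-census `pub-omega`, family (b3), seat pub-omega-group gen 34.  Framing: lottery ticket; floor = certified bounds/negative
ranges.  VALUE: the TILING form of `ThreeSetNoPartThreeGeneral.card_le_of_cube_form_part_three`, which is the common
denominator of the cube SYMMETRIC form (odd `|A|`, `cube_symmetric_form_of_law`) and the cube SHIFTED form (any `|A|`,
`cube_shifted_form_of_law`): both are partitions of `A ∖ {pt}` into translates of `W` and of `−W` in the ratio `2 : 1`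
(sequel `CubeShiftedFormNoPartThree.lean`); NOT progress on ω.

A *triangle tiling* of `A ∖ {z₀}` (counting form): Finsets `T, M ⊆ A`, a three-element `W = {w, w + u, w + v}`, and
`#{m ∈ M : m − a ∈ W} + #{t ∈ T : a − t ∈ W} = [a ≠ z₀]` for every `a` (the tiles `m − W`, `t + W` partition `A ∖ {z₀}`).
* `sum_card_filter_comm` — double counting.
* **`closure_eq_top_of_tiling`** — the tiling-form coset lemma: `u, v` generate `A`.  (Every tile lies in one coset of
  `H = ⟨u, v⟩`; summing the counting identity over a coset gives `3 ∣ |H| − [z₀ ∈ coset]`, so `3 ∣ |H|` and `3 ∣ |H| − 1`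
  if `H ≠ A`.)
* `tiling_count` — `3(|M| + |T|) + 1 = |A|`.
* **`card_le_of_tiling_part_three`** — if moreover `|T| = 2|M|`, then `|A| ≤ 12 · addOrderOf (w' − w) + 7` for any two
  distinct `w, w' ∈ W` (re-centre `W` at `w`, then `card_sub_card_bound_general` = Theorem B on the sheared torus).
-/

namespace Summit.MatrixMultiplication.OmegaCensus

open Finset

section Tiling

variable {A : Type*} [AddCommGroup A] [DecidableEq A] [Fintype A]

omit [AddCommGroup A] [DecidableEq A] [Fintype A] in
/-- Double counting of an incidence relation between two Finsets. [folklore] -/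
theorem sum_card_filter_comm (C M : Finset A) (P : A → A → Prop) [DecidableRel P] :
    ∑ a ∈ C, (M.filter fun m => P m a).card = ∑ m ∈ M, (C.filter fun a => P m a).card := by
  simp_rw [card_filter]
  exact Finset.sum_comm

omit [Fintype A] in
/-- The points of a down-tile `m − {0, u, v}` inside a set `C` closed under `± u`, `± v`: all three or none. [folklore] -/
theorem card_filter_sub_mem_triple {C : Finset A} {u v : A} (hu : u ≠ 0) (hv : v ≠ 0) (huv : u ≠ v)
    (hC : ∀ a, a ∈ C → (a - u ∈ C ∧ a - v ∈ C)) (hC' : ∀ a, (a - u ∈ C ∨ a - v ∈ C) → a ∈ C) (m : A) :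
    (C.filter fun a => m - a ∈ ({0, u, v} : Finset A)).card = if m ∈ C then 3 else 0 := by
  split_ifs with hm
  · have e : (C.filter fun a => m - a ∈ ({0, u, v} : Finset A)) = {m, m - u, m - v} := by
      ext a
      simp only [mem_filter, mem_insert, mem_singleton]
      constructor
      · rintro ⟨-, h | h | h⟩
        · exact Or.inl (sub_eq_zero.1 h).symm
        · exact Or.inr (Or.inl (by rw [← h]; abel))
        · exact Or.inr (Or.inr (by rw [← h]; abel))
      · rintro (rfl | rfl | rfl)
        · exact ⟨hm, Or.inl (sub_self _)⟩
        · exact ⟨(hC _ hm).1, Or.inr (Or.inl (sub_sub_cancel _ _))⟩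
        · exact ⟨(hC _ hm).2, Or.inr (Or.inr (sub_sub_cancel _ _))⟩
    have h1 : m ≠ m - u := fun h => hu (sub_eq_self.1 h.symm)
    have h2 : m ≠ m - v := fun h => hv (sub_eq_self.1 h.symm)
    have h3 : m - u ≠ m - v := fun h => huv (sub_right_injective h)
    rw [e, card_insert_of_notMem (by simp [h1, h2]), card_insert_of_notMem (by simp [h3]), card_singleton]
  · rw [card_eq_zero, filter_eq_empty_iff]
    intro a ha h
    simp only [mem_insert, mem_singleton] at h
    rcases h with h | h | h
    · exact hm ((sub_eq_zero.1 h) ▸ ha)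
    · exact hm (hC' m (Or.inl (by rw [← h, sub_sub_cancel]; exact ha)))
    · exact hm (hC' m (Or.inr (by rw [← h, sub_sub_cancel]; exact ha)))

omit [Fintype A] in
/-- The points of an up-tile `t + {0, u, v}` inside a set `C` closed under `± u`, `± v`: all three or none. [folklore] -/
theorem card_filter_sub_mem_triple' {C : Finset A} {u v : A} (hu : u ≠ 0) (hv : v ≠ 0) (huv : u ≠ v)
    (hC : ∀ a, a ∈ C → (a + u ∈ C ∧ a + v ∈ C)) (hC' : ∀ a, (a + u ∈ C ∨ a + v ∈ C) → a ∈ C) (t : A) :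
    (C.filter fun a => a - t ∈ ({0, u, v} : Finset A)).card = if t ∈ C then 3 else 0 := by
  split_ifs with ht
  · have e : (C.filter fun a => a - t ∈ ({0, u, v} : Finset A)) = {t, t + u, t + v} := by
      ext a
      simp only [mem_filter, mem_insert, mem_singleton]
      constructor
      · rintro ⟨-, h | h | h⟩
        · exact Or.inl (sub_eq_zero.1 h)
        · exact Or.inr (Or.inl (by rw [← h]; abel))
        · exact Or.inr (Or.inr (by rw [← h]; abel))
      · rintro (rfl | rfl | rfl)
        · exact ⟨ht, Or.inl (sub_self _)⟩
        · exact ⟨(hC _ ht).1, Or.inr (Or.inl (add_sub_cancel_left _ _))⟩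
        · exact ⟨(hC _ ht).2, Or.inr (Or.inr (add_sub_cancel_left _ _))⟩
    have h1 : t ≠ t + u := fun h => hu (left_eq_add.1 h)
    have h2 : t ≠ t + v := fun h => hv (left_eq_add.1 h)
    have h3 : t + u ≠ t + v := fun h => huv (add_left_cancel h)
    rw [e, card_insert_of_notMem (by simp [h1, h2]), card_insert_of_notMem (by simp [h3]), card_singleton]
  · rw [card_eq_zero, filter_eq_empty_iff]
    intro a ha h
    simp only [mem_insert, mem_singleton] at h
    rcases h with h | h | h
    · exact ht ((sub_eq_zero.1 h) ▸ ha)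
    · exact ht (hC' t (Or.inl (by rw [← h, add_sub_cancel]; exact ha)))
    · exact ht (hC' t (Or.inr (by rw [← h, add_sub_cancel]; exact ha)))

/-- **Tiling-form coset lemma: the two difference vectors of the tile generate `A`.**  If translates `m − {0,u,v}`
(`m ∈ M`) and `t + {0,u,v}` (`t ∈ T`) partition `A ∖ {z₀}`, then `⟨u, v⟩ = A`. [folklore] -/
theorem closure_eq_top_of_tiling {u v z₀ : A} {T M : Finset A} (hu : u ≠ 0) (hv : v ≠ 0) (huv : u ≠ v)
    (h : ∀ a, (M.filter fun m => m - a ∈ ({0, u, v} : Finset A)).card +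
      (T.filter fun t => a - t ∈ ({0, u, v} : Finset A)).card = if a = z₀ then 0 else 1) :
    AddSubgroup.closure ({u, v} : Set A) = ⊤ := by
  classical
  set H := AddSubgroup.closure ({u, v} : Set A) with hH_def
  have huH : u ∈ H := AddSubgroup.subset_closure (by simp)
  have hvH : v ∈ H := AddSubgroup.subset_closure (by simp)
  by_contra hH
  -- cosets `C b = b + H` as Finsets
  set C : A → Finset A := fun b => univ.filter fun a : A => a - b ∈ H with hC_def
  have memC : ∀ {a b : A}, a ∈ C b ↔ a - b ∈ H := fun {a b} => by simp [hC_def]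
  have hCcard : ∀ b : A, (C b).card = (univ.filter fun a : A => a ∈ H).card := by
    intro b
    have : C b = (univ.filter fun a : A => a ∈ H).image (· + b) := by
      ext a
      simp only [memC, mem_filter, mem_univ, true_and, mem_image]
      exact ⟨fun ha => ⟨a - b, ha, sub_add_cancel a b⟩, fun ⟨c, hc, hca⟩ => by rw [← hca, add_sub_cancel_right]; exact hc⟩
    rw [this, card_image_of_injective _ (add_left_injective b)]
  -- closure of cosets under ± u, ± v
  have cl : ∀ b a x : A, x ∈ H → (a ∈ C b ↔ a + x ∈ C b) := by
    intro b a x hx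
    rw [memC, memC, show a + x - b = (a - b) + x by abel]
    exact ⟨fun ha => H.add_mem ha hx, fun ha => by simpa using H.sub_mem ha hx⟩
  -- summing the counting identity over a coset: `3 ∣ #(C b ∖ {z₀})`
  have key : ∀ b : A, 3 ∣ ((C b).erase z₀).card := by
    intro b
    have hsum : ∑ a ∈ C b, ((M.filter fun m => m - a ∈ ({0, u, v} : Finset A)).card +
        (T.filter fun t => a - t ∈ ({0, u, v} : Finset A)).card) = ∑ a ∈ C b, (if a = z₀ then 0 else 1 : ℕ) :=
      sum_congr rfl fun a _ => h a
    have hrhs : ∑ a ∈ C b, (if a = z₀ then 0 else 1 : ℕ) = ((C b).erase z₀).card := by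
      rw [← filter_ne', card_filter]
      exact sum_congr rfl fun a _ => by by_cases ha : a = z₀ <;> simp [ha]
    have hM : ∑ a ∈ C b, (M.filter fun m => m - a ∈ ({0, u, v} : Finset A)).card =
        3 * (M.filter fun m => m ∈ C b).card := by
      rw [sum_card_filter_comm, card_filter, mul_sum]
      refine sum_congr rfl fun m _ => ?_
      rw [card_filter_sub_mem_triple hu hv huv (fun a ha => ⟨?_, ?_⟩) (fun a ha => ?_) m]
      · split_ifs <;> simp
      · rw [sub_eq_add_neg]; exact (cl b a (-u) (H.neg_mem huH)).1 ha
      · rw [sub_eq_add_neg]; exact (cl b a (-v) (H.neg_mem hvH)).1 ha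
      · rcases ha with ha | ha
        · have := (cl b (a - u) u huH).1 ha; rwa [sub_add_cancel] at this
        · have := (cl b (a - v) v hvH).1 ha; rwa [sub_add_cancel] at this
    have hT : ∑ a ∈ C b, (T.filter fun t => a - t ∈ ({0, u, v} : Finset A)).card =
        3 * (T.filter fun t => t ∈ C b).card := by
      rw [sum_card_filter_comm, card_filter, mul_sum]
      refine sum_congr rfl fun t _ => ?_
      rw [card_filter_sub_mem_triple' hu hv huv (fun a ha => ⟨(cl b a u huH).1 ha, (cl b a v hvH).1 ha⟩)
        (fun a ha => ?_) t]
      · split_ifs <;> simp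
      · rcases ha with ha | ha
        · exact (cl b a u huH).2 ha
        · exact (cl b a v hvH).2 ha
    rw [sum_add_distrib, hM, hT, hrhs, ← mul_add] at hsum
    exact Dvd.intro _ hsum
  -- the coset of `z₀`: `3 ∣ |H| − 1`; a coset avoiding `z₀`: `3 ∣ |H|`
  have k₁ := key z₀
  rw [card_erase_of_mem (memC.2 (by simp [H.zero_mem])), hCcard] at k₁
  obtain ⟨g, hg⟩ : ∃ g : A, g ∉ H := by
    by_contra hall
    push Not at hall
    exact hH (eq_top_iff.2 fun g _ => hall g)
  have k₂ := key (z₀ - g)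
  rw [erase_eq_of_notMem (by rw [memC]; simpa using hg), hCcard] at k₂
  have hpos : 1 ≤ (univ.filter fun a : A => a ∈ H).card := card_pos.2 ⟨0, by simp [H.zero_mem]⟩
  have := Nat.dvd_sub k₂ k₁
  rw [show (univ.filter fun a : A => a ∈ H).card - ((univ.filter fun a : A => a ∈ H).card - 1) = 1 by omega] at this
  omega

/-- **Counting a triangle tiling**: `3(|M| + |T|) + 1 = |A|`. [folklore] -/
theorem tiling_count {u v z₀ : A} {T M : Finset A} (hu : u ≠ 0) (hv : v ≠ 0) (huv : u ≠ v)
    (h : ∀ a, (M.filter fun m => m - a ∈ ({0, u, v} : Finset A)).card +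
      (T.filter fun t => a - t ∈ ({0, u, v} : Finset A)).card = if a = z₀ then 0 else 1) :
    3 * (M.card + T.card) + 1 = Fintype.card A := by
  classical
  have hsum : ∑ a : A, ((M.filter fun m => m - a ∈ ({0, u, v} : Finset A)).card +
      (T.filter fun t => a - t ∈ ({0, u, v} : Finset A)).card) = ∑ a : A, (if a = z₀ then 0 else 1 : ℕ) :=
    sum_congr rfl fun a _ => h a
  have hrhs : ∑ a : A, (if a = z₀ then 0 else 1 : ℕ) = (univ.erase z₀).card := by
    rw [← filter_ne', card_filter]
    exact sum_congr rfl fun a _ => by by_cases ha : a = z₀ <;> simp [ha]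
  have hM : ∑ a : A, (M.filter fun m => m - a ∈ ({0, u, v} : Finset A)).card = 3 * M.card := by
    rw [sum_card_filter_comm, show 3 * M.card = ∑ m ∈ M, 3 by simp [mul_comm]]
    refine sum_congr rfl fun m _ => ?_
    rw [card_filter_sub_mem_triple hu hv huv (fun a _ => ⟨mem_univ _, mem_univ _⟩) (fun a _ => mem_univ _) m,
      if_pos (mem_univ _)]
  have hT : ∑ a : A, (T.filter fun t => a - t ∈ ({0, u, v} : Finset A)).card = 3 * T.card := by
    rw [sum_card_filter_comm, show 3 * T.card = ∑ t ∈ T, 3 by simp [mul_comm]]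
    refine sum_congr rfl fun t _ => ?_
    rw [card_filter_sub_mem_triple' hu hv huv (fun a _ => ⟨mem_univ _, mem_univ _⟩) (fun a _ => mem_univ _) t,
      if_pos (mem_univ _)]
  rw [sum_add_distrib, hM, hT, hrhs, card_erase_of_mem (mem_univ _), card_univ] at hsum
  have : 0 < Fintype.card A := Fintype.card_pos
  omega

omit [Fintype A] in
/-- Re-centring a tiling: with `W = w + {0, u, v}`, the tiles `m − W`, `t + W` are the tiles `(m − w) − {0,u,v}`,
`(t + w) + {0,u,v}`. [folklore] -/
theorem tiling_recentre {W T M : Finset A} {z₀ w u v : A} (hW : W = {w, w + u, w + v})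
    (h : ∀ a, (M.filter fun m => m - a ∈ W).card + (T.filter fun t => a - t ∈ W).card = if a = z₀ then 0 else 1)
    (a : A) :
    ((M.image (· - w)).filter fun m => m - a ∈ ({0, u, v} : Finset A)).card +
      ((T.image (· + w)).filter fun t => a - t ∈ ({0, u, v} : Finset A)).card = if a = z₀ then 0 else 1 := by
  rw [← h a, filter_image, card_image_of_injective _ (sub_left_injective), filter_image,
    card_image_of_injective _ (add_left_injective w)]
  have key : ∀ y : A, y ∈ W ↔ y - w ∈ ({0, u, v} : Finset A) := by
    intro y
    rw [hW]
    simp only [mem_insert, mem_singleton]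
    constructor
    · rintro (h | h | h)
      · rw [h]; exact Or.inl (sub_self _)
      · rw [h]; exact Or.inr (Or.inl (add_sub_cancel_left _ _))
      · rw [h]; exact Or.inr (Or.inr (add_sub_cancel_left _ _))
    · rintro (h | h | h)
      · exact Or.inl (sub_eq_zero.1 h)
      · exact Or.inr (Or.inl (by rw [← h]; abel))
      · exact Or.inr (Or.inr (by rw [← h]; abel))
  congr 2
  · ext m
    simp only [mem_filter, key, and_congr_right_iff]
    intro; rw [show m - w - a = m - a - w by abel]
  · ext t
    simp only [mem_filter, key, and_congr_right_iff]
    intro; rw [show a - (t + w) = a - t - w by abel]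

/-- **Main theorem, tiling form.**  If translates `m − W` (`m ∈ M`) and `t + W` (`t ∈ T`) of a three-element set `W`
partition `A ∖ {z₀}` with `|T| = 2|M|`, then `|A| ≤ 12 · addOrderOf (w' − w) + 7` for any two distinct `w, w' ∈ W`.
[folklore] -/
theorem card_le_of_tiling_part_three {W T M : Finset A} {z₀ : A}
    (h : ∀ a, (M.filter fun m => m - a ∈ W).card + (T.filter fun t => a - t ∈ W).card = if a = z₀ then 0 else 1)
    (hW : W.card = 3) (hTM : T.card = 2 * M.card) {w w' : A} (hw : w ∈ W) (hw' : w' ∈ W) (hne : w ≠ w') :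
    Fintype.card A ≤ 12 * addOrderOf (w' - w) + 7 := by
  classical
  -- the third point and the re-centred tile `{0, u, v}`
  obtain ⟨w'', hw''W, hw''w, hw''w'⟩ : ∃ w'' ∈ W, w'' ≠ w ∧ w'' ≠ w' := by
    have hc : ((W.erase w).erase w').card = 1 := by
      rw [card_erase_of_mem (mem_erase.2 ⟨hne.symm, hw'⟩), card_erase_of_mem hw, hW]
    obtain ⟨w'', hw''⟩ := card_eq_one.1 hc
    have hm : w'' ∈ (W.erase w).erase w' := by rw [hw'']; exact mem_singleton_self _
    exact ⟨w'', (mem_erase.1 (mem_erase.1 hm).2).2, (mem_erase.1 (mem_erase.1 hm).2).1, (mem_erase.1 hm).1⟩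
  set u : A := w'' - w with hu_def
  set v : A := w' - w with hv_def
  have hWeq : W = {w, w + u, w + v} := by
    rw [eq_triple_of_card_three hW hw hw''W hw' hw''w.symm hne hw''w', hu_def, hv_def, add_sub_cancel, add_sub_cancel]
  have hu : u ≠ 0 := sub_ne_zero.2 hw''w
  have hv : v ≠ 0 := sub_ne_zero.2 hne.symm
  have huv : u ≠ v := fun e => hw''w' (sub_left_injective e)
  have h' := tiling_recentre hWeq h
  -- generation, counting, Theorem B
  have hgen' := closure_eq_top_of_tiling hu hv huv h'
  have hgen : ∀ x : A, ∃ i k : ℤ, i • u + k • v = x := fun x =>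
    AddSubgroup.mem_closure_pair.1 (by rw [hgen']; exact AddSubgroup.mem_top x)
  have hcount := tiling_count hu hv huv h'
  rw [card_image_of_injective _ (sub_left_injective), card_image_of_injective _ (add_left_injective w), hTM] at hcount
  have h3 : ¬ 3 ∣ addOrderOf v := by
    intro h3
    have : 3 ∣ Fintype.card A := h3.trans addOrderOf_dvd_card
    omega
  have hb := card_sub_card_bound_general u v hu hv huv hgen h3 _ _ _ h'
  rw [card_image_of_injective _ (sub_left_injective), card_image_of_injective _ (add_left_injective w), hTM,
    Nat.cast_mul, show ((2 : ℕ) : ℤ) * (M.card : ℤ) - M.card = M.card by ring, abs_of_nonneg (by positivity)] at hb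
  have : (3 * M.card : ℤ) ≤ 4 * addOrderOf v + 2 := by exact_mod_cast hb
  have hc' : (3 * (M.card + 2 * M.card) + 1 : ℤ) = Fintype.card A := by exact_mod_cast hcount
  have : (Fintype.card A : ℤ) ≤ 12 * addOrderOf v + 7 := by linarith
  exact_mod_cast this

end Tiling

end Summit.MatrixMultiplication.OmegaCensus
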